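import Summits.QuantumFields.YangMills.Theorems.BalabanUVNodesN27AtRecord13CoPHHome
import Summits.QuantumFields.YangMills.Theorems.BalabanUVNodesSpineRatesHolder

/-!
# BalabanUVNodes ∕ N27 = binder B5 AT THE RECORD — XXXVIIIᶜᵒᵖᴴ AT EXPONENT `β` («R-β», W-SEAT START LIST §n27 (W-d); plan g82 WORD «n27-w1 take (W-d)» l.≈28060): N27 AT THE CoPH-KEYED
# STAGE-13 CANONICAL CARRIER HOMES OF RECORD `YMDAG.UVSplit.SRec₁₃CoPH cr` ∕ `YMDAG.UVSplit.RRec₁₃CoPH 𝔯` WITH NODE N16's STUB IN ITS CURRENCY OF RECORD `S_N16Holder β (RRec₁₃CoPH 𝔯)` (dag-n16-c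
# `N16HolderDefs`) AND THE HOME-KEYED N19′ EDGE READING `RatesHolderAt … β` OVER ALL RUN LENGTHS (dag-n16-e 41ᴴ `…SpineRatesHolder`: `RateInputsAllHolder (RRec₁₃CoPH 𝔯) β`, `SpineRates_of_forall_holder`) —
# the R-β twin of module XXXVIIIᶜᵒᵖᴴ `…N27AtRecord13CoPHHome` (dag-n27-c g9), the canonical-home sibling of (Q) §1 `…N27AtRecord13CoPHHolder` (regime homes)
# (cell `pub-ymgap`, HUMAN RULING D-0062 Track A; director-ym №197 ∕ HUMAN RULING D-0149; width seat `pub-ymgap-dag-n27-w1` gen 2 on NODE n27 (B5 composite); K3⁷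
# `SpineGivenEndpointR13SepCoPH` = stmt-QuantumFields-20544, `--kind proof --supports 20544 --as helper`; COUNT-NEUTRAL; THEOREMS ONLY, 0 `def`, 0 `sorry`; `N`-generic, NO Theses import; regime module only —
# no item-facing leaf from this seat, dag-lead DEDUP-372 §n27 ownership note v60)

THE KNIT.  XII `spine_of_coreEdge` at `(Rec := ₁₃CCoPH, SRec₁₃CoPH cr, RateInputsAllHolder (RRec₁₃CoPH 𝔯) β)`, K4's ∀-hook by 41ᴴ `SpineRates_of_forall_holder` (the β-rates need NO `S_R00x`: the ∀-hook
is vacuous where no bundle is pinned), K5's `S_N27x ∕ S_N20 ∕ S_N21` at `SRec₁₃CoPH cr`, and the HOME-KEYED N19′ edge at exponent `β` (`h19`): for every admissible Stage-13 `θ` with provisos, every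
`g₀, os`, every datum key `h : IsDatumOfRecord₁₃CCoPH F N (datumOfRecord₁₃CoPH F N θ hP)` of θ's OWN datum, the β-rates at EVERY run length of the CANONICAL bundle `rateCarriersOfRecord₁₃CoPH 𝔯 F h.params
h.provisos g₀ os k` give SOME summable `δ` carrying `NE7.Core` on the shell-free cores of `cr F θ hP g₀ os`.

WHAT IS KERNEL-CHECKED ([bookkeeping]; 0 `def`, 0 `sorry`): `coreEdge_of_homes₁₃CoPH_holder` (the home-keyed all-run-lengths β-edge gives XII's edge at `(SRec₁₃CoPH cr, RateInputsAllHolder (RRec₁₃CoPH 𝔯)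
β)`) · ★★ `spine_rec13CCoPH_of_homes₁₃CoPH_holder` (⇒ `Spine ₁₃CCoPH`) · `spine_rec13CCoPH_of_homes₁₃CoPH_holder_faces` (the same with the spine-side stubs read through the home's faces — N20
`RelWeightBound` ∕ N21 `ShellWeightBound` at `cr F θ hP g₀ os`, N27x's unconditional θ-form).

HONEST FRAMING.  COMPOSITE-node bookkeeping BY NAME: every K4 ∕ K5 stub and the edge are HYPOTHESES with no producer at the canonical Stage-13 homes today (0∕1); β is a LETTER (the consumers' window
`2∕3 < β < 1` is theirs); the readings `cr`, `𝔯` are PARAMETERS (no reading of Bałaban's dressed expansion ∕ dressed tower of record exists); NE3 at exponent β, NE7 ∕ NE7b ∕ NE7c NOT PRINTED for d = 4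
and NOT PROVED; nothing of Bałaban's asserted or instantiated; no ₁₃ inhabitant claimed (K0⁷ OPEN); NO node discharged; K3⁷ OPEN, NOT claimed; the β = 1 storey XXXVIIIᶜᵒᵖᴴ and every landed decl UNTOUCHED
(additive file); LOWEST-value storey of the row by the plan's own grading (the item reads the REGIME class — (Q) §1 — not the canonical class); counts UNMOVED (typed 28∕28 · discharged 5∕27, A 5∕28);
one finite four-torus programme at fixed `ε` — R4 closes the conditional rung `BalabanLadder.UV` only: NOT ℝ⁴, NOT infinite volume, NOT OS, NOT a mass gap, NOT Clay.  No decl below carries a cite tag.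
-/

set_option autoImplicit false

namespace Summit.QuantumFields.YangMills.Theorems.BalabanUVNodesN27SpineRecord

open Literature.MathematicalPhysics.QuantumFieldTheory.Balaban1983to89
open Literature.MathematicalPhysics.QuantumFieldTheory.Balaban1983to89.T4Continuum
open T4WeightBudget (RelWeightBound)
open T4IndicatorShell (ShellWeightBound)
open T4ContinuumYM4Torus (ForSmallCouplings)
open Summit.QuantumFields.BalabanUV.T4Continuum.Spine
open YMDAG.UVSplit
open Node00 (Stage13HParams datumOfRecord₁₃CoPH IsRecordOfRecord₁₃CCoPH IsDatumOfRecord₁₃CCoPH isDatumOfRecord₁₃CCoPH_datumOfRecord₁₃CoPH)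
open Summit.QuantumFields.YangMills.BalabanUVNodes.N16HolderDefs (N16HolderAt S_N16Holder)
open Summit.QuantumFields.YangMills.BalabanUVNodes.SpineRatesHolder (RatesHolderAt RateInputsAllHolder SpineRates_of_forall_holder)

variable {N : ℕ} [NeZero N] (cr : SpineReading₁₃CoPH N) (β : ℝ) (𝔯 : RateReading₁₃CoPH N)

/-! ## §1 The home-keyed N19′ edge at exponent `β`, all run lengths -/

/-- **XII's N19′ EDGE AT `(SRec₁₃CoPH cr, RateInputsAllHolder (RRec₁₃CoPH 𝔯) β)`** (XXXVIIIᶜᵒᵖᴴ `coreEdge_of_homes₁₃CoPH` with `RatesAt ↦ RatesHolderAt … β` and the all-run-lengths hook): a bundle pinned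
by `SRec₁₃CoPH cr` is `cr F θ hP g₀ os` for an admissible θ with provisos realising `D`; θ's own datum HAS a datum key (`isDatumOfRecord₁₃CCoPH_datumOfRecord₁₃CoPH`), at which every run length of
the canonical bundle is pinned by `RRec₁₃CoPH 𝔯` (`rRec₁₃CoPH_self`) — so the home-keyed edge `h19` fires. [bookkeeping] -/
theorem coreEdge_of_homes₁₃CoPH_holder
    (h19 : ∀ (F : T4Family) (θ : Stage13HParams F N) (hP : θ.Provisos₁₃CoPH F N), θ.Admissible F N → ∀ (g₀ : ℕ → ℝ) (os : List (ULoop F))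
      (h : IsDatumOfRecord₁₃CCoPH F N (datumOfRecord₁₃CoPH F N θ hP)),
      (∀ k : ℕ, RatesHolderAt (datumOfRecord₁₃CoPH F N θ hP) (rateCarriersOfRecord₁₃CoPH 𝔯 F h.params h.provisos g₀ os k) β) → letI := (cr F θ hP g₀ os).dec
        ∃ δ : ℕ → ℝ, NE7.Core (cr F θ hP g₀ os).l₀ (cr F θ hP g₀ os).vol (cr F θ hP g₀ os).T (cr F θ hP g₀ os).Bad
          (fun K t τ => (cr F θ hP g₀ os).A K t τ - (cr F θ hP g₀ os).shA K t τ) (fun K t τ => (cr F θ hP g₀ os).B K t τ - (cr F θ hP g₀ os).shB K t τ) δ ∧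
          Summable δ)
    (F : T4Family) (D : Datum F N) (g₀ : ℕ → ℝ) (os : List (ULoop F)) (S : SpineCarriers) (hS : SRec₁₃CoPH cr F D g₀ os S)
    (hin : RateInputsAllHolder (RRec₁₃CoPH 𝔯) β F D g₀ os) :
    letI := S.dec
      ∃ δ : ℕ → ℝ, NE7.Core S.l₀ S.vol S.T S.Bad (fun K t τ => S.A K t τ - S.shA K t τ) (fun K t τ => S.B K t τ - S.shB K t τ) δ ∧ Summable δ := by
  obtain ⟨θ, hP, hθ, rfl, rfl⟩ := hS
  exact h19 F θ hP hθ g₀ os (isDatumOfRecord₁₃CCoPH_datumOfRecord₁₃CoPH F N θ hP hθ) fun k => hin _ (rRec₁₃CoPH_self 𝔯 _ g₀ os k)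

/-! ## §2 The knit at the canonical homes, R-β -/

/-- ★★ **N27 = B5 AT THE STAGE-13 RECORD FROM THE STUB INSTANCES OF THE TWO CANONICAL CARRIER HOMES OF RECORD AT EXPONENT `β` AND THE HOME-KEYED N19′ EDGE** (XII `spine_of_coreEdge` at
`(₁₃CCoPH, SRec₁₃CoPH cr, RateInputsAllHolder (RRec₁₃CoPH 𝔯) β)`, K4's ∀-hook by 41ᴴ `SpineRates_of_forall_holder`): `h16 : S_N16Holder β (RRec₁₃CoPH 𝔯)`, the other five K4 stubs and K5's three at the
homes, `h19`.  Every stub a HYPOTHESIS (0∕1 today); NE3 at exponent β NOT PROVED. [bookkeeping] -/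
theorem spine_rec13CCoPH_of_homes₁₃CoPH_holder (h14 : S_N14 (RRec₁₃CoPH 𝔯)) (h15 : S_N15 (RRec₁₃CoPH 𝔯)) (h16 : S_N16Holder β (RRec₁₃CoPH 𝔯)) (h17 : S_N17 (RRec₁₃CoPH 𝔯))
    (h18 : S_N18 (RRec₁₃CoPH 𝔯)) (h22 : S_N22 (RRec₁₃CoPH 𝔯)) (hx' : S_N27x (fun F D w => IsRecordOfRecord₁₃CCoPH F N D w) (SRec₁₃CoPH cr)) (h20 : S_N20 (SRec₁₃CoPH cr))
    (h21 : S_N21 (SRec₁₃CoPH cr))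
    (h19 : ∀ (F : T4Family) (θ : Stage13HParams F N) (hP : θ.Provisos₁₃CoPH F N), θ.Admissible F N → ∀ (g₀ : ℕ → ℝ) (os : List (ULoop F))
      (h : IsDatumOfRecord₁₃CCoPH F N (datumOfRecord₁₃CoPH F N θ hP)),
      (∀ k : ℕ, RatesHolderAt (datumOfRecord₁₃CoPH F N θ hP) (rateCarriersOfRecord₁₃CoPH 𝔯 F h.params h.provisos g₀ os k) β) → letI := (cr F θ hP g₀ os).dec
        ∃ δ : ℕ → ℝ, NE7.Core (cr F θ hP g₀ os).l₀ (cr F θ hP g₀ os).vol (cr F θ hP g₀ os).T (cr F θ hP g₀ os).Bad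
          (fun K t τ => (cr F θ hP g₀ os).A K t τ - (cr F θ hP g₀ os).shA K t τ) (fun K t τ => (cr F θ hP g₀ os).B K t τ - (cr F θ hP g₀ os).shB K t τ) δ ∧
          Summable δ) :
    Spine (N := N) fun F D w => IsRecordOfRecord₁₃CCoPH F N D w :=
  spine_of_coreEdge _ (SRec₁₃CoPH cr) (RateInputsAllHolder (RRec₁₃CoPH 𝔯) β) hx' h20 h21 (coreEdge_of_homes₁₃CoPH_holder cr β 𝔯 h19)
    (SpineRates_of_forall_holder _ (RRec₁₃CoPH 𝔯) h14 h15 h16 h17 h18 h22)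

/-- **THE SAME WITH THE SPINE-SIDE STUBS READ THROUGH THE HOME's FACES** (XXXVIIIᶜᵒᵖᴴ `…_faces` at exponent `β`): N20 `RelWeightBound` ∕ N21 `ShellWeightBound` at `cr F θ hP g₀ os` for every admissible
Stage-13 θ with provisos, N27x's unconditional θ-form; rate stubs as in `spine_rec13CCoPH_of_homes₁₃CoPH_holder`. [bookkeeping] -/
theorem spine_rec13CCoPH_of_homes₁₃CoPH_holder_faces (h14 : S_N14 (RRec₁₃CoPH 𝔯)) (h15 : S_N15 (RRec₁₃CoPH 𝔯)) (h16 : S_N16Holder β (RRec₁₃CoPH 𝔯))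
    (h17 : S_N17 (RRec₁₃CoPH 𝔯)) (h18 : S_N18 (RRec₁₃CoPH 𝔯)) (h22 : S_N22 (RRec₁₃CoPH 𝔯))
    (hx : ∀ (F : T4Family) (θ : Stage13HParams F N) (hP : θ.Provisos₁₃CoPH F N), θ.Admissible F N → ∀ (g₀ : ℕ → ℝ) (os : List (ULoop F)),
      0 < (cr F θ hP g₀ os).l₀ ∧ 0 < (cr F θ hP g₀ os).vol ∧
        (∀ (K : ℕ) (t : ℝ), |t| ≤ (cr F θ hP g₀ os).l₀ →
          T4GenFunBounds.schemeZ ((datumOfRecord₁₃CoPH F N θ hP).scheme g₀) os ((cr F θ hP g₀ os).K₀ + K) t =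
            ∑ τ ∈ (cr F θ hP g₀ os).T K, (cr F θ hP g₀ os).A K t τ) ∧
        (∀ (K : ℕ) (t : ℝ), |t| ≤ (cr F θ hP g₀ os).l₀ →
          T4GenFunBounds.schemeZ ((datumOfRecord₁₃CoPH F N θ hP).scheme g₀) os ((cr F θ hP g₀ os).K₀ + K + 1) t =
            ∑ τ ∈ (cr F θ hP g₀ os).T K, (cr F θ hP g₀ os).B K t τ))
    (h20 : ∀ (F : T4Family) (θ : Stage13HParams F N) (hP : θ.Provisos₁₃CoPH F N), θ.Admissible F N → ∀ (g₀ : ℕ → ℝ) (os : List (ULoop F)),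
      RelWeightBound (cr F θ hP g₀ os).l₀ (cr F θ hP g₀ os).T (cr F θ hP g₀ os).A (cr F θ hP g₀ os).B (cr F θ hP g₀ os).Bad (cr F θ hP g₀ os).W)
    (h21 : ∀ (F : T4Family) (θ : Stage13HParams F N) (hP : θ.Provisos₁₃CoPH F N), θ.Admissible F N → ∀ (g₀ : ℕ → ℝ) (os : List (ULoop F)),
      ShellWeightBound (cr F θ hP g₀ os).l₀ (cr F θ hP g₀ os).T (cr F θ hP g₀ os).A (cr F θ hP g₀ os).B (cr F θ hP g₀ os).shA (cr F θ hP g₀ os).shB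
        (cr F θ hP g₀ os).Wsh)
    (h19 : ∀ (F : T4Family) (θ : Stage13HParams F N) (hP : θ.Provisos₁₃CoPH F N), θ.Admissible F N → ∀ (g₀ : ℕ → ℝ) (os : List (ULoop F))
      (h : IsDatumOfRecord₁₃CCoPH F N (datumOfRecord₁₃CoPH F N θ hP)),
      (∀ k : ℕ, RatesHolderAt (datumOfRecord₁₃CoPH F N θ hP) (rateCarriersOfRecord₁₃CoPH 𝔯 F h.params h.provisos g₀ os k) β) → letI := (cr F θ hP g₀ os).dec
        ∃ δ : ℕ → ℝ, NE7.Core (cr F θ hP g₀ os).l₀ (cr F θ hP g₀ os).vol (cr F θ hP g₀ os).T (cr F θ hP g₀ os).Bad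
          (fun K t τ => (cr F θ hP g₀ os).A K t τ - (cr F θ hP g₀ os).shA K t τ) (fun K t τ => (cr F θ hP g₀ os).B K t τ - (cr F θ hP g₀ os).shB K t τ) δ ∧
          Summable δ) :
    Spine (N := N) fun F D w => IsRecordOfRecord₁₃CCoPH F N D w :=
  spine_rec13CCoPH_of_homes₁₃CoPH_holder cr β 𝔯 h14 h15 h16 h17 h18 h22 (s_N27x_sRec₁₃CoPH_of cr hx) ((s_N20_sRec₁₃CoPH_iff cr).mpr h20)
    ((s_N21_sRec₁₃CoPH_iff cr).mpr h21) h19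

end Summit.QuantumFields.YangMills.Theorems.BalabanUVNodesN27SpineRecord
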